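import Summits.QuantumFields.BalabanUV.Beta.FP.BlockAveragedKernelDipole
import Literature.MathematicalPhysics.QuantumFieldTheory.Balaban1983to89.Beta.AxialComposition

/-!
# Road FP (binder row D1), row H′2-IR ∕ IR-1-ABS — PART 3: THE INSTANCE AT BAŁABAN's STRAIGHT-CONTOUR BLOCK AVERAGE
# (`AxialComposition.axialAvg`, the tree's transcription of [B5] (1.11)∕(1.18)): THE OWNER's (i) VALUE PROFILE,
# (ii) x-DIFFERENCES ONE POWER BETTER, (iii) THE DOUBLE AVERAGE `covAvg` IN COARSE DISTANCE (our bookkeeping; no estimate of any propagator)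

HONEST DEPENDENCY (page 1, mandatory): continuum YM on T⁴ ⇐ BetaPertH ∧ nine spine estimates (0/9 proved); BetaPertH ⇐ (D1) ∧ (D4) ∧
CAP+tail; G-an2-4 gates asym, D1 and NE2/3/4.  HONEST FRAMING (cell contract, verbatim): «discharging `BetaPertH` makes Bałaban's UV
stability UNCONDITIONAL — a real constructive-QFT result; it is NOT the continuum limit and NOT the Clay problem.»  THIS MODULE is
elementary real analysis on finite sums over `ℤ⁴` (our bookkeeping): it cites nothing, mints no `def … : Prop`, declares no data `def`,
has 0 `sorry`.  The averaging operation is the TREE's `AxialComposition.axialAvg` ∕ `covAvg` (an3-g5's transcription of the printed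
block-and-contour average of [Balaban1984PropagatorsI] (1.11) p. 19 ∕ (1.18) p. 20 in integer coordinates — a DEFINITION, read BY NAME;
nothing printed is used as a hypothesis).  The kernel `P` is ARBITRARY with displayed letters.  It discharges NOTHING of row H′2-IR, of
`hasym`, of D1 or of `BetaPertH`; NOT (CONV-C), NOT D1, NOT the continuum limit, NOT Clay.

ABSOLUTE RULE (cell charter, verbatim): «No internally-minted statement may enter as a cited fact. Every hypothesis is either
kernel-proved in this package or a verbatim quotation of a PUBLISHED theorem with page reference. The manuscript(s) under audit are NOT
citable for their own disputed steps — they are the thing under adjudication; programme-internal (2001/route/tribunal) claims are never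
citable.»

THE ROW (owner d1-p3-g5, journal 2026-08-20T20:08:31Z «IR-1-ABS», `LEAVES-FP.md`): for `P : ℤ⁴ → ℝ` with `|P z| ≤ C₀(‖z‖∞+1)⁻²`,
`|P(z + e_i) − P z| ≤ C₀(‖z‖∞+1)⁻³` and the straight-contour block average at blocking `n ≥ 1`,
`A n μ x u := n⁻⁴·Σ_{y ∈ B(u)} Σ_{s<n} P(x − (y + s•e_μ))`: (i) `|A| ≤ C₁ n⁻¹(1 + dist∞(x, n•u)∕n)⁻²`, (ii) `|A(x + e_i) − A x| ≤ C₁ n⁻²(…)⁻²`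
(sharper `(…)⁻³`), (iii) the double average `≤ C₂ n⁻²(1 + |u − v|∞)⁻²`, constants n-FREE.  DICTIONARY: the tree's `axialAvg n μ f u =
n⁻⁵·Σ_{q ∈ idx n} f(n•u + pt μ q)` is the MASS-ONE average, so `A n μ x u = n · axialAvg n μ (v ↦ P(x − v)) u`; we prove the profiles for
`axialAvg` (and `covAvg`) and display the owner's `n·axialAvg` readings as corollaries.  MECHANISM: `axialAvg` IS a block sum over
`box 4 (2n)` against the weight profile `axialWeight n μ` (an3's `AxialBlockWeights`: mass `1`, flatness `≤ n⁻⁴`, support `‖m‖∞ ≤ 2n`), so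
PART 1's PROFILE (`FP/BlockAveragedKernel.abs_blockSum_le_profile`) and PART 2's double average apply with `W₁ = 1`, `W∞(ρ+1)⁴ ≤ 81`.

CONTENT.
* §1 `axialWeight_eq_zero_of_not_mem`, `axialSupport_subset_box`, **`axialAvg_eq_boxSum`** (`axialAvg n μ f u = Σ_{m ∈ box 4 (2n)} ω m·f(n•u + m)`),
  the letters `sum_box_abs_axialWeight_le` (mass ≤ 1), `abs_axialWeight_le` (flatness ≤ n⁻⁴), `axial_volume_le` (`n⁻⁴·(2n+1)⁴ ≤ 81`).
* §2 (i) **`abs_axialAvg_le_profile`** (`a ≤ 3`): `|axialAvg n μ (v ↦ P(x − v)) u| ≤ 3^a·531442·C₀ ∕ (2n + 1 + ‖x − n•u‖∞)^a`; the owner's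
  reading `abs_contourAvg_le` (`a = 2`): `n·|axialAvg …| ≤ 9·531442·C₀ ∕ (n·(1 + ‖x − n•u‖∞∕n)²)`; marginal `abs_axialAvg_le_profile_marginal`
  (`a = 4`: `≤ 81·(81·(97 + 64 log(6n)) + 1)·C₀ ∕ (2n+1+‖x − n•u‖∞)⁴`).
* §3 (ii) **`abs_axialAvg_fwdDiff_le_profile`** (`a + 1 ≤ 3`): `|axialAvg n μ (v ↦ P(x + e_i − v)) u − axialAvg n μ (v ↦ P(x − v)) u| ≤
  3^{a+1}·531442·C₁ ∕ (2n+1+‖x − n•u‖∞)^{a+1}`; the owner's reading `abs_contourAvg_fwdDiff_le` (`n·|…| ≤ 27·531442·C₁ ∕ (n²·(1 + dist∕n)³)`).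
* §4 (iii) `covAvg_eq_doubleBoxSum`, **`abs_covAvg_le_profile`** (`a ≤ 3`): `|covAvg n μ P u v| ≤ (3^a·531442)²·C₀ ∕ (2n+1+n·‖u − v‖∞)^a`, and in
  coarse distance `abs_covAvg_le_coarse`: `≤ (3^a·531442)²·C₀ ∕ (n^a·(1 + ‖u − v‖∞)^a)` — at `a = 2` the row's `C₂ n⁻²(1 + |u − v|∞)⁻²`.
Unit `b2b-balaban-gan24-formalise-leaf-04` (gen 39, idle G-an2-4 swarm leaf seat, cross-lane), 2026-08-20; `LEAVES-FP.md` rows IR-1-ABS ∕ IR-1-GEN.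
-/

noncomputable section

namespace Summit.QuantumFields.BalabanUV.Beta.FP.BlockAveragedKernelAxial

open Finset
open scoped BigOperators
open Literature.Probability.LatticeModels (box mem_box zero_mem_box)
open Literature.MathematicalPhysics.QuantumFieldTheory.Balaban1983to89.Beta.DyadicShell
  (Pt supNorm supNorm_le_iff mem_box_iff supNorm_eq_zero_iff)
open Literature.MathematicalPhysics.QuantumFieldTheory.Balaban1983to89.Beta.BlockLegs (supNorm_nsmul_real)
open Literature.MathematicalPhysics.QuantumFieldTheory.Balaban1983to89.Beta.AxialBlockWeights
  (idx pt axialSupport fiber axialWeight axialWeight_nonneg sum_axialWeight axialWeight_le supNorm_le_of_mem)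
open Literature.MathematicalPhysics.QuantumFieldTheory.Balaban1983to89.Beta.AxialComposition (axialAvg covAvg axialAvg_eq_weights
  covAvg_eq_axialAvg₂)
open Summit.QuantumFields.BalabanUV.Beta.FP.BlockAveragedKernel
open Summit.QuantumFields.BalabanUV.Beta.FP.BlockAveragedKernelDipole

/-! ## §1 The axial block weights as a weight profile on `box 4 (2n)` -/

/-- [our bookkeeping] Off its support the axial weight vanishes (empty fibre). -/
theorem axialWeight_eq_zero_of_not_mem {n : ℕ} {μ : Fin 4} {m : Pt} (hm : m ∉ axialSupport n μ) : axialWeight n μ m = 0 := by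
  unfold axialWeight
  have h : fiber n μ m = ∅ := by
    refine Finset.filter_eq_empty_iff.mpr fun q hq h => hm ?_
    exact mem_image.mpr ⟨q, hq, h⟩
  rw [h, card_empty, Nat.cast_zero, zero_div]

/-- [our bookkeeping] The support lies in the sup-box of radius `2n`. -/
theorem axialSupport_subset_box (n : ℕ) (μ : Fin 4) : axialSupport n μ ⊆ box 4 (2 * n) :=
  fun _ hm => mem_box_iff.mpr (supNorm_le_of_mem hm)

/-- **THE PRINTED AVERAGE AS A BLOCK SUM OVER THE SUP-BOX**: `axialAvg n μ f u = Σ_{m ∈ box 4 (2n)} axialWeight n μ m · f(n•u + m)`.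
[our bookkeeping] -/
theorem axialAvg_eq_boxSum (n : ℕ) (μ : Fin 4) (f : Pt → ℝ) (u : Pt) :
    axialAvg n μ f u = ∑ m ∈ box 4 (2 * n), axialWeight n μ m * f (n • u + m) := by
  rw [axialAvg_eq_weights]
  exact sum_subset (axialSupport_subset_box n μ) fun m _ hm => by rw [axialWeight_eq_zero_of_not_mem hm, zero_mul]

/-- [our bookkeeping] MASS LETTER: `Σ_{m ∈ box (2n)} |ω m| ≤ 1` (`n ≥ 1`; in fact `= 1`). -/
theorem sum_box_abs_axialWeight_le {n : ℕ} (hn : 1 ≤ n) (μ : Fin 4) :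
    ∑ m ∈ box 4 (2 * n), |axialWeight n μ m| ≤ 1 := by
  have h1 : ∑ m ∈ box 4 (2 * n), |axialWeight n μ m| = ∑ m ∈ box 4 (2 * n), axialWeight n μ m :=
    sum_congr rfl fun m _ => abs_of_nonneg (axialWeight_nonneg n μ m)
  have h2 : ∑ m ∈ axialSupport n μ, axialWeight n μ m = ∑ m ∈ box 4 (2 * n), axialWeight n μ m :=
    sum_subset (axialSupport_subset_box n μ) fun m _ hm => axialWeight_eq_zero_of_not_mem hm
  rw [h1, ← h2, sum_axialWeight hn]

/-- [our bookkeeping] FLATNESS LETTER: `|ω m| ≤ n⁻⁴`. -/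
theorem abs_axialWeight_le {n : ℕ} (hn : 1 ≤ n) (μ : Fin 4) (m : Pt) (_hm : m ∈ box 4 (2 * n)) :
    |axialWeight n μ m| ≤ 1 / (n : ℝ) ^ 4 := by
  rw [abs_of_nonneg (axialWeight_nonneg n μ m)]; exact axialWeight_le hn μ m

/-- [our bookkeeping] FLATNESS × VOLUME: `n⁻⁴·(2n+1)⁴ ≤ 81` (`n ≥ 1`). -/
theorem axial_volume_le {n : ℕ} (hn : 1 ≤ n) : 1 / (n : ℝ) ^ 4 * (((2 * n : ℕ) : ℝ) + 1) ^ 4 ≤ 81 := by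
  have hn' : (1 : ℝ) ≤ n := by exact_mod_cast hn
  have hpos : (0 : ℝ) < (n : ℝ) ^ 4 := by positivity
  rw [div_mul_eq_mul_div, one_mul, div_le_iff₀ hpos]
  have h : ((2 * n : ℕ) : ℝ) + 1 ≤ 3 * n := by push_cast; linarith
  calc (((2 * n : ℕ) : ℝ) + 1) ^ 4 ≤ (3 * (n : ℝ)) ^ 4 := pow_le_pow_left₀ (by positivity) h 4
    _ = 81 * (n : ℝ) ^ 4 := by ring

/-- [our bookkeeping] The PART-1 amplitude at the axial letters: `3^b·(6561·n⁻⁴·(2n+1)⁴ + 1)·C ≤ 3^b·531442·C`. -/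
theorem axial_amplitude_le {n : ℕ} (hn : 1 ≤ n) (b : ℕ) {C : ℝ} (hC : 0 ≤ C) :
    3 ^ b * (6561 * (1 / (n : ℝ) ^ 4) * (((2 * n : ℕ) : ℝ) + 1) ^ 4 + 1) * C ≤ 3 ^ b * 531442 * C := by
  have h := axial_volume_le hn
  have h' : 6561 * (1 / (n : ℝ) ^ 4) * (((2 * n : ℕ) : ℝ) + 1) ^ 4 + 1 ≤ 531442 := by nlinarith
  gcongr

/-! ## §2 (i) THE VALUE PROFILE of the block-and-contour average of a graded kernel -/

/-- **(i) THE VALUE PROFILE.**  `|P z| ≤ C₀∕(‖z‖∞+1)^a`, `a ≤ 3`, `n ≥ 1` ⟹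
`|axialAvg n μ (v ↦ P(x − v)) u| ≤ 3^a·531442·C₀ ∕ (2n + 1 + ‖x − n•u‖∞)^a`. [our bookkeeping] -/
theorem abs_axialAvg_le_profile {P : Pt → ℝ} {C₀ : ℝ} {a : ℕ} (ha : a ≤ 3)
    (hP : ∀ z, |P z| ≤ C₀ / ((supNorm z : ℝ) + 1) ^ a) {n : ℕ} (hn : 1 ≤ n) (μ : Fin 4) (x u : Pt) :
    |axialAvg n μ (fun v => P (x - v)) u| ≤ 3 ^ a * 531442 * C₀ / ((((2 * n : ℕ) : ℝ)) + 1 + supNorm (x - n • u)) ^ a := by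
  have hC := letter_nonneg_of_le hP
  rw [axialAvg_eq_boxSum]
  have e : ∀ m ∈ box 4 (2 * n), axialWeight n μ m * P (x - (n • u + m)) = axialWeight n μ m * P ((x - n • u) - m) := by
    intro m _; rw [sub_sub]
  rw [sum_congr rfl e]
  refine (abs_blockSum_le_profile ha hP (sum_box_abs_axialWeight_le hn μ) (abs_axialWeight_le hn μ) (x - n • u)).trans ?_
  exact div_le_div_of_nonneg_right (axial_amplitude_le hn a hC) (by positivity)

/-- [our bookkeeping] `2n + 1 + d ≥ n·(1 + d∕n)` (`n ≥ 1`), in the form used to pass to the owner's `n^{−a}(1 + dist∕n)^{−a}` reading. -/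
theorem scale_le_shift {n : ℕ} (hn : 1 ≤ n) (d : ℝ) :
    (n : ℝ) * (1 + d / n) ≤ (((2 * n : ℕ) : ℝ)) + 1 + d := by
  have hn' : (1 : ℝ) ≤ n := by exact_mod_cast hn
  have hn0 : (n : ℝ) ≠ 0 := by positivity
  rw [mul_add, mul_one, mul_div_cancel₀ _ hn0]
  push_cast; linarith

/-- **(i) IN THE OWNER's CURRENCY** (`A n μ x u = n·axialAvg …`, `a = 2`): `n·|axialAvg n μ (v ↦ P(x − v)) u| ≤ 9·531442·C₀ ∕ (n·(1 + ‖x − n•u‖∞∕n)²)`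
= `C₁·n⁻¹·(1 + dist∕n)⁻²`. [our bookkeeping] -/
theorem abs_contourAvg_le {P : Pt → ℝ} {C₀ : ℝ} (hP : ∀ z, |P z| ≤ C₀ / ((supNorm z : ℝ) + 1) ^ 2)
    {n : ℕ} (hn : 1 ≤ n) (μ : Fin 4) (x u : Pt) :
    (n : ℝ) * |axialAvg n μ (fun v => P (x - v)) u|
      ≤ 9 * 531442 * C₀ / ((n : ℝ) * (1 + (supNorm (x - n • u) : ℝ) / n) ^ 2) := by
  have hC := letter_nonneg_of_le hP
  have hn' : (1 : ℝ) ≤ n := by exact_mod_cast hn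
  have h := abs_axialAvg_le_profile (a := 2) (by norm_num) hP hn μ x u
  have hs := scale_le_shift hn (supNorm (x - n • u) : ℝ)
  have hX : (0 : ℝ) < (n : ℝ) * (1 + (supNorm (x - n • u) : ℝ) / n) := by positivity
  calc (n : ℝ) * |axialAvg n μ (fun v => P (x - v)) u|
      ≤ (n : ℝ) * (3 ^ 2 * 531442 * C₀ / ((((2 * n : ℕ) : ℝ)) + 1 + supNorm (x - n • u)) ^ 2) :=
        mul_le_mul_of_nonneg_left h (by positivity)
    _ ≤ (n : ℝ) * (3 ^ 2 * 531442 * C₀ / ((n : ℝ) * (1 + (supNorm (x - n • u) : ℝ) / n)) ^ 2) := by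
        gcongr
    _ = 9 * 531442 * C₀ / ((n : ℝ) * (1 + (supNorm (x - n • u) : ℝ) / n) ^ 2) := by
        field_simp
        ring

/-- **(i), MARGINAL DEGREE `a = 4`**: `|P z| ≤ C₀∕(‖z‖∞+1)⁴` ⟹ `|axialAvg n μ (v ↦ P(x − v)) u| ≤ 81·(81·(97 + 64·log(6n)) + 1)·C₀ ∕ (2n+1+‖x − n•u‖∞)⁴`
— one logarithm of the block scale (PART 2 §9). [our bookkeeping] -/
theorem abs_axialAvg_le_profile_marginal {P : Pt → ℝ} {C₀ : ℝ}
    (hP : ∀ z, |P z| ≤ C₀ / ((supNorm z : ℝ) + 1) ^ 4) {n : ℕ} (hn : 1 ≤ n) (μ : Fin 4) (x u : Pt) :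
    |axialAvg n μ (fun v => P (x - v)) u|
      ≤ 81 * (81 * (97 + 64 * Real.log ((3 * (2 * n) : ℕ) : ℝ)) + 1) * C₀ / ((((2 * n : ℕ) : ℝ)) + 1 + supNorm (x - n • u)) ^ 4 := by
  have hC := letter_nonneg_of_le hP
  rw [axialAvg_eq_boxSum]
  have e : ∀ m ∈ box 4 (2 * n), axialWeight n μ m * P (x - (n • u + m)) = axialWeight n μ m * P ((x - n • u) - m) := by
    intro m _; rw [sub_sub]
  rw [sum_congr rfl e]
  refine (abs_blockSum_le_profile_marginal hP (sum_box_abs_axialWeight_le hn μ) (abs_axialWeight_le hn μ) (x - n • u)).trans ?_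
  refine div_le_div_of_nonneg_right ?_ (by positivity)
  have hlog : 0 ≤ 97 + 64 * Real.log ((3 * (2 * n) : ℕ) : ℝ) := by
    have := Real.log_natCast_nonneg (3 * (2 * n)); linarith
  have hv := axial_volume_le hn
  have : 1 / (n : ℝ) ^ 4 * (((2 * n : ℕ) : ℝ) + 1) ^ 4 * (97 + 64 * Real.log ((3 * (2 * n) : ℕ) : ℝ))
      ≤ 81 * (97 + 64 * Real.log ((3 * (2 * n) : ℕ) : ℝ)) := mul_le_mul_of_nonneg_right hv hlog
  gcongr

/-! ## §3 (ii) x-DIFFERENCES ARE ONE POWER BETTER -/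

/-- **(ii) THE DIFFERENCE PROFILE.**  `|P(z + e_i) − P z| ≤ C₁∕(‖z‖∞+1)^{a+1}`, `a + 1 ≤ 3`, `n ≥ 1` ⟹
`|axialAvg n μ (v ↦ P(x + e_i − v)) u − axialAvg n μ (v ↦ P(x − v)) u| ≤ 3^{a+1}·531442·C₁ ∕ (2n+1+‖x − n•u‖∞)^{a+1}`. [our bookkeeping] -/
theorem abs_axialAvg_fwdDiff_le_profile {P : Pt → ℝ} {C₁ : ℝ} {a : ℕ} (ha : a + 1 ≤ 3) (i : Fin 4)
    (hΔ : ∀ z, |P (z + Pi.single i 1) - P z| ≤ C₁ / ((supNorm z : ℝ) + 1) ^ (a + 1)) {n : ℕ} (hn : 1 ≤ n) (μ : Fin 4) (x u : Pt) :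
    |axialAvg n μ (fun v => P (x + Pi.single i 1 - v)) u - axialAvg n μ (fun v => P (x - v)) u|
      ≤ 3 ^ (a + 1) * 531442 * C₁ / ((((2 * n : ℕ) : ℝ)) + 1 + supNorm (x - n • u)) ^ (a + 1) := by
  have hC : 0 ≤ C₁ := letter_nonneg_of_le (K := fun z => P (z + Pi.single i 1) - P z) hΔ
  rw [axialAvg_eq_boxSum, axialAvg_eq_boxSum]
  have e1 : ∀ m ∈ box 4 (2 * n), axialWeight n μ m * P (x + Pi.single i 1 - (n • u + m))
      = axialWeight n μ m * P ((x - n • u) + Pi.single i 1 - m) := by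
    intro m _; congr 2; abel
  have e2 : ∀ m ∈ box 4 (2 * n), axialWeight n μ m * P (x - (n • u + m)) = axialWeight n μ m * P ((x - n • u) - m) := by
    intro m _; rw [sub_sub]
  rw [sum_congr rfl e1, sum_congr rfl e2]
  refine (abs_blockSum_fwdDiff_le_profile ha i hΔ (sum_box_abs_axialWeight_le hn μ) (abs_axialWeight_le hn μ) (x - n • u)).trans ?_
  exact div_le_div_of_nonneg_right (axial_amplitude_le hn (a + 1) hC) (by positivity)

/-- **(ii) IN THE OWNER's CURRENCY** (`n·axialAvg`, degree `3`, the sharper cube): `n·|Δ| ≤ 27·531442·C₁ ∕ (n²·(1 + ‖x − n•u‖∞∕n)³)`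
= `C₁′·n⁻²·(1 + dist∕n)⁻³ ≤ C₁′·n⁻²·(1 + dist∕n)⁻²`. [our bookkeeping] -/
theorem abs_contourAvg_fwdDiff_le {P : Pt → ℝ} {C₁ : ℝ} (i : Fin 4)
    (hΔ : ∀ z, |P (z + Pi.single i 1) - P z| ≤ C₁ / ((supNorm z : ℝ) + 1) ^ 3) {n : ℕ} (hn : 1 ≤ n) (μ : Fin 4) (x u : Pt) :
    (n : ℝ) * |axialAvg n μ (fun v => P (x + Pi.single i 1 - v)) u - axialAvg n μ (fun v => P (x - v)) u|
      ≤ 27 * 531442 * C₁ / ((n : ℝ) ^ 2 * (1 + (supNorm (x - n • u) : ℝ) / n) ^ 3) := by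
  have hC : 0 ≤ C₁ := letter_nonneg_of_le (K := fun z => P (z + Pi.single i 1) - P z) hΔ
  have hn' : (1 : ℝ) ≤ n := by exact_mod_cast hn
  have h := abs_axialAvg_fwdDiff_le_profile (a := 2) (by norm_num) i hΔ hn μ x u
  have hs := scale_le_shift hn (supNorm (x - n • u) : ℝ)
  have hX : (0 : ℝ) < (n : ℝ) * (1 + (supNorm (x - n • u) : ℝ) / n) := by positivity
  calc (n : ℝ) * |axialAvg n μ (fun v => P (x + Pi.single i 1 - v)) u - axialAvg n μ (fun v => P (x - v)) u|
      ≤ (n : ℝ) * (3 ^ (2 + 1) * 531442 * C₁ / ((((2 * n : ℕ) : ℝ)) + 1 + supNorm (x - n • u)) ^ (2 + 1)) :=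
        mul_le_mul_of_nonneg_left h (by positivity)
    _ ≤ (n : ℝ) * (3 ^ (2 + 1) * 531442 * C₁ / ((n : ℝ) * (1 + (supNorm (x - n • u) : ℝ) / n)) ^ (2 + 1)) := by
        gcongr
    _ = 27 * 531442 * C₁ / ((n : ℝ) ^ 2 * (1 + (supNorm (x - n • u) : ℝ) / n) ^ 3) := by
        field_simp
        ring

/-! ## §4 (iii) THE DOUBLE AVERAGE `covAvg` — the `Q_n P Q_nᵀ` entry shape -/

/-- [our bookkeeping] The double block-and-contour average as a double block sum over the sup-boxes against the axial weights. -/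
theorem covAvg_eq_doubleBoxSum (n : ℕ) (μ : Fin 4) (P : Pt → ℝ) (u v : Pt) :
    covAvg n μ P u v = ∑ m ∈ box 4 (2 * n), ∑ m' ∈ box 4 (2 * n),
      axialWeight n μ m * axialWeight n μ m' * P (n • u + m - (n • v + m')) := by
  rw [covAvg_eq_axialAvg₂, axialAvg_eq_boxSum]
  refine sum_congr rfl fun m _ => ?_
  rw [axialAvg_eq_boxSum, mul_sum]
  refine sum_congr rfl fun m' _ => ?_
  ring

/-- **(iii) THE DOUBLE-AVERAGE PROFILE.**  `|P z| ≤ C₀∕(‖z‖∞+1)^a`, `a ≤ 3`, `n ≥ 1` ⟹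
`|covAvg n μ P u v| ≤ (3^a·531442)·((3^a·531442)·C₀) ∕ (2n + 1 + ‖n•u − n•v‖∞)^a`. [our bookkeeping] -/
theorem abs_covAvg_le_profile {P : Pt → ℝ} {C₀ : ℝ} {a : ℕ} (ha : a ≤ 3)
    (hP : ∀ z, |P z| ≤ C₀ / ((supNorm z : ℝ) + 1) ^ a) {n : ℕ} (hn : 1 ≤ n) (μ : Fin 4) (u v : Pt) :
    |covAvg n μ P u v|
      ≤ (3 ^ a * 531442) * (3 ^ a * 531442 * C₀) / ((((2 * n : ℕ) : ℝ)) + 1 + supNorm (n • u - n • v)) ^ a := by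
  have hC := letter_nonneg_of_le hP
  rw [covAvg_eq_doubleBoxSum]
  refine (abs_doubleBlockSum_le_profile ha hP (sum_box_abs_axialWeight_le hn μ) (abs_axialWeight_le hn μ)
    (sum_box_abs_axialWeight_le hn μ) (abs_axialWeight_le hn μ) (n • u) (n • v)).trans ?_
  refine div_le_div_of_nonneg_right ?_ (by positivity)
  have h1 := axial_amplitude_le hn a hC
  have h2 := axial_amplitude_le hn a (C := 3 ^ a * 531442 * C₀) (by positivity)
  have h0 : 0 ≤ 3 ^ a * (6561 * (1 / (n : ℝ) ^ 4) * (((2 * n : ℕ) : ℝ) + 1) ^ 4 + 1) := by positivity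
  calc 3 ^ a * (6561 * (1 / (n : ℝ) ^ 4) * (((2 * n : ℕ) : ℝ) + 1) ^ 4 + 1)
        * (3 ^ a * (6561 * (1 / (n : ℝ) ^ 4) * (((2 * n : ℕ) : ℝ) + 1) ^ 4 + 1) * C₀)
      ≤ 3 ^ a * (6561 * (1 / (n : ℝ) ^ 4) * (((2 * n : ℕ) : ℝ) + 1) ^ 4 + 1) * (3 ^ a * 531442 * C₀) :=
        mul_le_mul_of_nonneg_left h1 h0
    _ ≤ 3 ^ a * 531442 * (3 ^ a * 531442 * C₀) := h2

/-- **(iii) IN COARSE DISTANCE** (the owner's reading): `|covAvg n μ P u v| ≤ (3^a·531442)²·C₀ ∕ (n^a·(1 + ‖u − v‖∞)^a)` — at `a = 2`,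
`C₂·n⁻²·(1 + |u − v|∞)⁻²`. [our bookkeeping] -/
theorem abs_covAvg_le_coarse {P : Pt → ℝ} {C₀ : ℝ} {a : ℕ} (ha : a ≤ 3)
    (hP : ∀ z, |P z| ≤ C₀ / ((supNorm z : ℝ) + 1) ^ a) {n : ℕ} (hn : 1 ≤ n) (μ : Fin 4) (u v : Pt) :
    |covAvg n μ P u v| ≤ (3 ^ a * 531442) ^ 2 * C₀ / ((n : ℝ) ^ a * (1 + (supNorm (u - v) : ℝ)) ^ a) := by
  have hC := letter_nonneg_of_le hP
  have hn' : (1 : ℝ) ≤ n := by exact_mod_cast hn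
  refine (abs_covAvg_le_profile ha hP hn μ u v).trans ?_
  have hsm : (supNorm (n • u - n • v) : ℝ) = n * supNorm (u - v) := by
    rw [← smul_sub, supNorm_nsmul_real]
  rw [hsm, ← mul_pow, show (3 ^ a * 531442) * (3 ^ a * 531442 * C₀) = ((3 : ℝ) ^ a * 531442) ^ 2 * C₀ by ring]
  refine div_le_div_of_nonneg_left (by positivity) (by positivity) (pow_le_pow_left₀ (by positivity) ?_ a)
  have h0 : (0 : ℝ) ≤ supNorm (u - v) := Nat.cast_nonneg _
  push_cast
  nlinarith

end Summit.QuantumFields.BalabanUV.Beta.FP.BlockAveragedKernelAxial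

end
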